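import Summits.HodgeConjecture.HodgeConjecture.Theses.HeckePrymWeil
import Summits.HodgeConjecture.HodgeConjecture.Theorems.WeilTwelvefoldsSqrtMinus7.Negative.KillPropagation

/-!
# `WeilTenfoldsSqrtMinus11` (stmt-HodgeConjecture-1262) · Negative · where a kill would propagate

Negative-side knowledge for the crux `HeckePrymWeil.WeilTenfoldsSqrtMinus11`, from the standing
disprover's work file `Cruxes/WeilTenfoldsSqrtMinus11/Disproof.lean` §A
(refuter-cdisprove-stmt-HodgeConjecture-1262-g2-0, cycle 2, 2026-08-16); negative forms and pure
ladder logic only (companion of `WeilTwelvefoldsSqrtMinus7/Negative/KillPropagation` at `p = 7`, whose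
`descend_logic` is reused):

* `not_hodgeWeilLadder_of_not` : `¬ crux → ¬ HodgeWeilLadder` (the crux is rung `(11, 2)` of the
  target 1259, so a refutation of the crux refutes the target).
* `not_hwa11_of_not` : `WeilDescending → ¬ crux → ¬ HWA(11, m)` for every `m ≥ 5` (the rung predicate
  of dimension `2m` written out verbatim as in `HodgeWeilLadder` / `WeilDescending`; no new definition)
  — with the route's component-free descending lemma (support 1263) a kill of the tenfold rung kills
  EVERY higher `ℚ(√-11)` rung: all Hecke–Prym rungs `(11, g')`, `g' ≥ 2` (`not_rung11_of_not`), and the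
  twelvefold shadow `m = 6` through which crux idea `weil-projector-graph-seeds` attacks the crux (its
  proved `crux_of_twelvefolds`, contraposed); `rung11_of_hodgeWeilLadder` records that the target hands
  out every such rung. Conversely the crux with `WeilDescending` yields every LOWER rung (dimensions
  `2, 4, 6, 8`), and dimensions `≤ 4` are theorems in print (Markman 2025 for fourfolds), so no lower
  rung offers a refutation handle either.
-/

noncomputable section

namespace Summit.HodgeConjecture.HodgeConjecture.Theorems.WeilTenfoldsSqrtMinus11.Negative

open Summit.HodgeConjecture.HodgeConjecture.Theses.HeckePrymWeil
open CategoryTheory Literature.AlgebraicGeometry Literature.AlgebraicGeometry.HodgeTheory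
open Summit.HodgeConjecture.HodgeConjecture.Theorems.WeilTwelvefoldsSqrtMinus7.Negative (descend_logic)

/-- **A kill of the crux kills the target**: `WeilTenfoldsSqrtMinus11` is rung `(p, g', n) = (11, 2, 5)`
of `HodgeWeilLadder` (the casts `((11:ℕ):ℤ)`, `Real.sqrt ((11:ℕ):ℝ)` and `2 * 5` normalise by `simp`).
[folklore] -/
theorem not_hodgeWeilLadder_of_not (h : ¬ WeilTenfoldsSqrtMinus11) : ¬ HodgeWeilLadder := by
  intro hL
  apply h
  intro A φ hdim hφ c hrat hhodge hweil
  have h' := hL 11 (by norm_num) (by norm_num) (by norm_num) 2 le_rfl 5 (by norm_num) A φ hdim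
    (by simpa using hφ) c hrat hhodge
  simpa using h' (by simpa using hweil)

/-- **Given `WeilDescending`, a kill of the crux kills EVERY higher rung of the `p = 11` ladder**:
for all `m ≥ 5`, `¬ crux → ¬ HWA(11, m)` where `HWA(11, m)` is the rung predicate in dimension `2m`
typed verbatim as in `HodgeWeilLadder` / `WeilDescending` (descend `m → m-1 → ⋯ → 5`). In particular
the twelvefold shadow `m = 6` of crux idea `weil-projector-graph-seeds` (its `crux_of_twelvefolds`,
contraposed) dies with the crux. [folklore] -/
theorem not_hwa11_of_not (hD : WeilDescending) (h : ¬ WeilTenfoldsSqrtMinus11) {m : ℕ} (hm : 5 ≤ m) :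
    ¬ (∀ (A : Motives.AbelianVariety ℂ) (φ : A ⟶ A), A.dim = (2 * m) →
        CategoryStruct.comp φ φ = -((((11 : ℕ) : ℤ)) • CategoryStruct.id A) →
        ∀ c : complexBetti A.X (2 * m), IsRationalClass c → IsOfHodgeType (2 * m) A.X (2 * m) m m c →
          c ∈ Module.End.eigenspace (complexBetti.map (CategoryStruct.id A + φ).hom.hom.hom (2 * m)).hom
                ((1 + Complex.I * (Real.sqrt ((11 : ℕ) : ℝ) : ℂ)) ^ (2 * m)) ⊔
              Module.End.eigenspace (complexBetti.map (CategoryStruct.id A + φ).hom.hom.hom (2 * m)).hom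
                ((1 - Complex.I * (Real.sqrt ((11 : ℕ) : ℝ) : ℂ)) ^ (2 * m)) →
          c ∈ algebraicClasses A.X m) := by
  intro hM
  apply h
  -- descend from rung `m` to rung `5` with the route's one-step rule at `p = 11`
  have h5 := descend_logic _ (hD 11 (by norm_num) (by norm_num) (by norm_num)) (by norm_num) hm hM
  intro A φ hdim hφ c hrat hhodge hweil
  have h' := h5 A φ hdim (by simpa using hφ) c hrat hhodge
  simpa using h' (by simpa using hweil)

/-- The Hecke–Prym rungs of the `p = 11` ladder: `WeilDescending → ¬ crux → ¬ rung (11, g')` for every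
`g' ≥ 2` (dimension `10 (g' - 1) ≥ 10`; rung `(11, g')` is the `p = 11`, `g = g'` instance of the body of
`HodgeWeilLadder`). Conversely the crux with `WeilDescending` gives every LOWER rung (dimensions
`2, 4, 6, 8`), where dimensions `≤ 4` are theorems in print — no lower rung is a refutation handle.
[cite: Markman2025SecantWeil, §1.1] -/
theorem not_rung11_of_not (hD : WeilDescending) (h : ¬ WeilTenfoldsSqrtMinus11) {g : ℕ} (hg : 2 ≤ g) :
    ¬ (∀ n : ℕ, n = (11 - 1) / 2 * (g - 1) →
      ∀ (A : Motives.AbelianVariety ℂ) (φ : A ⟶ A), A.dim = (2 * n) →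
        CategoryStruct.comp φ φ = -((((11 : ℕ) : ℤ)) • CategoryStruct.id A) →
        ∀ c : complexBetti A.X (2 * n), IsRationalClass c → IsOfHodgeType (2 * n) A.X (2 * n) n n c →
          c ∈ Module.End.eigenspace (complexBetti.map (CategoryStruct.id A + φ).hom.hom.hom (2 * n)).hom
                ((1 + Complex.I * (Real.sqrt ((11 : ℕ) : ℝ) : ℂ)) ^ (2 * n)) ⊔
              Module.End.eigenspace (complexBetti.map (CategoryStruct.id A + φ).hom.hom.hom (2 * n)).hom
                ((1 - Complex.I * (Real.sqrt ((11 : ℕ) : ℝ) : ℂ)) ^ (2 * n)) →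
          c ∈ algebraicClasses A.X n) := fun hR =>
  not_hwa11_of_not hD h (m := 5 * (g - 1)) (by omega) (hR _ (by norm_num))

/-- The target hands the route EVERY Hecke–Prym rung at `p = 11`; so (with `WeilDescending`) the three
statements `¬ crux`, `¬ rung (11, 2)`, `¬ HodgeWeilLadder` are successively weaker consequences of one
another: `HodgeWeilLadder → rung (11, g')` for all `g' ≥ 2`, by instantiation. [folklore] -/
theorem rung11_of_hodgeWeilLadder (hL : HodgeWeilLadder) {g : ℕ} (hg : 2 ≤ g) :
    ∀ n : ℕ, n = (11 - 1) / 2 * (g - 1) →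
      ∀ (A : Motives.AbelianVariety ℂ) (φ : A ⟶ A), A.dim = (2 * n) →
        CategoryStruct.comp φ φ = -((((11 : ℕ) : ℤ)) • CategoryStruct.id A) →
        ∀ c : complexBetti A.X (2 * n), IsRationalClass c → IsOfHodgeType (2 * n) A.X (2 * n) n n c →
          c ∈ Module.End.eigenspace (complexBetti.map (CategoryStruct.id A + φ).hom.hom.hom (2 * n)).hom
                ((1 + Complex.I * (Real.sqrt ((11 : ℕ) : ℝ) : ℂ)) ^ (2 * n)) ⊔
              Module.End.eigenspace (complexBetti.map (CategoryStruct.id A + φ).hom.hom.hom (2 * n)).hom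
                ((1 - Complex.I * (Real.sqrt ((11 : ℕ) : ℝ) : ℂ)) ^ (2 * n)) →
          c ∈ algebraicClasses A.X n :=
  hL 11 (by norm_num) (by norm_num) (by norm_num) g hg

end Summit.HodgeConjecture.HodgeConjecture.Theorems.WeilTenfoldsSqrtMinus11.Negative

end
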